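import Mathlib.Algebra.BigOperators.Ring.Finset
import Mathlib.Data.Real.Basic
import Mathlib.Tactic.Linarith
import Mathlib.Tactic.Ring
import Mathlib.Algebra.Order.BigOperators.Ring.Finset
import Mathlib.Data.Finset.SymmDiff
import Mathlib.Data.Fintype.Powerset
import Summits.CriticalPhenomena.PercolationContinuityZ3.Theorems.PercNearOneGluingNoHeavyLowerTailTwoPartitionThreeSet

/-!
# The two-copy FIBRE DECOMPOSITION: a bilinear functional of two independent samples of a product measure on `2^α` is a positive
# mixture of its ANTIPODAL fibre sums — "two-copy comb positivity ⇒ positivity for every product measure"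

Support file (seat `prim-masterthm-p3`, gen 25; `--supports stmt-CriticalPhenomena-4575`; HIERARCHY §33, memo
`FROM-prim-masterthm-p3-g25-SYMMETRIC-CENSUS-AND-SQKD.md` §3.3).  The bookkeeping that `…TwoPartitionKleitman` left undone ("the formal bridge
fibre sum = functional of the sections"), done ONCE for an arbitrary kernel `K`:

* `prodW w S = ∏_i (w_i if i ∈ S else 1 − w_i)` — the product (Bernoulli) weight of `S ⊆ α`; `sum_prodW : Σ_S prodW w S = 1`.
* **`sum_sum_prodW_mul_eq_sum_fibre`**: `Σ_S Σ_T prodW S · prodW T · K S T = Σ_{(I,D) disjoint} W(I,D) · Σ_{x ⊆ D} K (I ∪ x) (I ∪ (D ∖ x))` with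
  `W(I,D) = ∏_{i∈I} w_i² · ∏_{i∈D} w_i(1−w_i) · ∏_{i∉I∪D} (1−w_i)² ≥ 0` — group the pairs `(S,T)` by `(S ∩ T, S ∆ T)`; inside a fibre the pair is
  `(I ∪ x, I ∪ (D∖x))`, an ANTIPODAL pair of the cube `2^D`.
* **`sum_sum_prodW_mul_nonneg_of_fibre`**: if every fibre sum is `≥ 0` (a statement about up-sets of the cubes `2^D` only) then the two-sample
  expectation is `≥ 0` for EVERY `w ∈ [0,1]^α`.
Applications (same file): the degree-2 comb statements of the hierarchy become inequalities for all product measures — `twoPartN ≥ 0` gives Harris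
(`harris_of_twoPartN`, a second proof of a Mathlib fact, as a check of the machine), and the CONJECTURE `ThreeSetAntipodal` (…TwoPartitionThreeSet)
gives **`sqkd_of_threeSetAntipodal`**: `(1 + P𝒜)·P(𝒜∩ℬ∩𝒞) ≥ P(𝒜∩ℬ)·P(𝒜∩𝒞) + P𝒜·P(ℬ∩𝒞)` for up-sets under every product measure on `2^(Fin n)`
— i.e. `Cov(1_{A∩B},1_{A∩C}) ≥ P(A)·P(B∩C∖A)` CONDITIONALLY on the conjecture.  HONEST LABEL: bookkeeping + one conditional corollary; standard axioms. [this work]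
-/

namespace Summit.CriticalPhenomena.PercolationContinuityZ3.Theorems.TwoPartition

open Finset
open scoped FinsetFamily symmDiff

variable {α : Type*} [DecidableEq α] [Fintype α]
/-! ### Product weights -/

/-- The product (Bernoulli) weight of a set `S` for coordinate probabilities `w`. [this work] -/
def prodW (w : α → ℝ) (S : Finset α) : ℝ := ∏ i, (if i ∈ S then w i else 1 - w i)

/-- Product weights are nonnegative for `w ∈ [0,1]^α`. [folklore] -/
theorem prodW_nonneg {w : α → ℝ} (hw : ∀ i, 0 ≤ w i ∧ w i ≤ 1) (S : Finset α) : 0 ≤ prodW w S :=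
  prod_nonneg fun i _ => by split_ifs <;> linarith [hw i]

/-- The product weight as (product over `S`) × (product over the complement). [folklore] -/
theorem prodW_eq (w : α → ℝ) (S : Finset α) : prodW w S = (∏ i ∈ S, w i) * ∏ i ∈ univ \ S, (1 - w i) := by
  unfold prodW
  rw [← prod_sdiff (subset_univ S), mul_comm]
  congr 1
  · exact prod_congr rfl fun i hi => by rw [if_pos hi]
  · exact prod_congr rfl fun i hi => by rw [if_neg (mem_sdiff.1 hi).2]

/-- Product weights sum to one. [folklore] -/
theorem sum_prodW (w : α → ℝ) : ∑ S, prodW w S = 1 := by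
  have h := Finset.prod_add (fun i => w i) (fun i => 1 - w i) (univ : Finset α)
  simp only [add_sub_cancel, prod_const_one] at h
  rw [h, ← Finset.powerset_univ]
  exact Finset.sum_congr rfl fun S _ => prodW_eq w S

/-- The fibre weight `W(I,D) = ∏_{i∈I} w_i² · ∏_{i∈D} w_i(1−w_i) · ∏_{i∉I∪D}(1−w_i)²`, written pointwise. [this work] -/
def fibreW (w : α → ℝ) (I D : Finset α) : ℝ :=
  ∏ i, (if i ∈ I then w i * w i else if i ∈ D then w i * (1 - w i) else (1 - w i) * (1 - w i))

/-- Fibre weights are nonnegative for `w ∈ [0,1]^α`. [this work] -/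
theorem fibreW_nonneg {w : α → ℝ} (hw : ∀ i, 0 ≤ w i ∧ w i ≤ 1) (I D : Finset α) : 0 ≤ fibreW w I D :=
  prod_nonneg fun i _ => by
    rcases hw i with ⟨h0, h1⟩
    split_ifs <;> first | exact mul_nonneg h0 h0 | exact mul_nonneg h0 (by linarith) | exact mul_nonneg (by linarith) (by linarith)

/-- Inside the fibre `(I,D)` the product of the two weights is the fibre weight, whatever `x ⊆ D` is. [this work] -/
theorem prodW_mul_prodW_fibre (w : α → ℝ) {I D x : Finset α} (hID : Disjoint I D) (hx : x ⊆ D) :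
    prodW w (I ∪ x) * prodW w (I ∪ (D \ x)) = fibreW w I D := by
  unfold prodW fibreW
  rw [← prod_mul_distrib]
  refine prod_congr rfl fun i _ => ?_
  by_cases hI : i ∈ I
  · have hD : i ∉ D := fun h => disjoint_left.1 hID hI h
    simp [hI, hD]
  · by_cases hD : i ∈ D
    · by_cases hxi : i ∈ x
      · simp [hI, hD, hxi]
      · simp [hI, hD, hxi]; ring
    · have hxi : i ∉ x := fun h => hD (hx h)
      simp [hI, hD, hxi]
/-! ### The fibre decomposition -/

/-- The index set of fibres-with-position: `⟨(I,D), x⟩` with `I ∩ D = ∅`, `x ⊆ D`. [this work] -/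
def fibreIdx (α : Type*) [DecidableEq α] [Fintype α] : Finset (Σ _ : Finset α × Finset α, Finset α) :=
  ((univ : Finset (Finset α × Finset α)).filter fun p => Disjoint p.1 p.2).sigma fun p => p.2.powerset

/-- **Fibre decomposition** of a two-sample sum: group `(S,T)` by `(S ∩ T, S ∆ T)`. [this work] -/
theorem sum_sum_prodW_mul_eq_sum_fibre (w : α → ℝ) (K : Finset α → Finset α → ℝ) :
    ∑ S, ∑ T, prodW w S * prodW w T * K S T =
      ∑ q ∈ fibreIdx α, fibreW w q.1.1 q.1.2 * K (q.1.1 ∪ q.2) (q.1.1 ∪ (q.1.2 \ q.2)) := by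
  rw [← Finset.sum_product' (f := fun S T => prodW w S * prodW w T * K S T), univ_product_univ]
  refine Finset.sum_nbij' (fun p => ⟨(p.1 ∩ p.2, p.1 ∆ p.2), p.1 \ p.2⟩) (fun q => (q.1.1 ∪ q.2, q.1.1 ∪ (q.1.2 \ q.2))) ?_ ?_ ?_ ?_ ?_
  · intro p _
    simp only [fibreIdx, mem_sigma, mem_filter, mem_univ, true_and, mem_powerset]
    constructor
    · rw [Finset.disjoint_left]; intro a ha hb
      rw [mem_inter] at ha; rw [mem_symmDiff] at hb; tauto
    · intro a ha; rw [mem_sdiff] at ha; rw [mem_symmDiff]; tauto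
  · intro q _; exact mem_univ _
  · intro p _
    obtain ⟨S, T⟩ := p
    ext a
    · simp only [mem_union, mem_inter, mem_sdiff]; tauto
    · simp only [mem_union, mem_inter, mem_sdiff, mem_symmDiff]; tauto
  · intro q hq
    obtain ⟨⟨I, D⟩, x⟩ := q
    simp only [fibreIdx, mem_sigma, mem_filter, mem_univ, true_and, mem_powerset] at hq
    obtain ⟨hID, hx⟩ := hq
    have hID' := Finset.disjoint_left.1 hID
    have e1 : (I ∪ x) ∩ (I ∪ (D \ x)) = I := by
      ext a; simp only [mem_inter, mem_union, mem_sdiff]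
      constructor
      · rintro ⟨h1 | h1, h2 | h2⟩
        · exact h1
        · exact h1
        · exact h2
        · exact absurd h1 h2.2
      · intro h; exact ⟨Or.inl h, Or.inl h⟩
    have e2 : (I ∪ x) ∆ (I ∪ (D \ x)) = D := by
      ext a; simp only [mem_symmDiff, mem_union, mem_sdiff]
      constructor
      · rintro (⟨h1 | h1, h2⟩ | ⟨h1 | h1, h2⟩)
        · exact absurd (Or.inl h1) h2
        · exact hx h1
        · exact absurd (Or.inl h1) h2
        · exact h1.1
      · intro hD
        have hI : a ∉ I := fun h => hID' h hD
        by_cases hax : a ∈ x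
        · exact Or.inl ⟨Or.inr hax, fun h => h.elim hI (fun h' => h'.2 hax)⟩
        · exact Or.inr ⟨Or.inr ⟨hD, hax⟩, fun h => h.elim hI hax⟩
    have e3 : (I ∪ x) \ (I ∪ (D \ x)) = x := by
      ext a; simp only [mem_sdiff, mem_union]
      constructor
      · rintro ⟨h1 | h1, h2⟩
        · exact absurd (Or.inl h1) h2
        · exact h1
      · intro hax
        exact ⟨Or.inr hax, fun h => h.elim (fun hI => hID' hI (hx hax)) (fun h' => h'.2 hax)⟩
    simp only [e1, e2, e3]
  · intro p _
    obtain ⟨S, T⟩ := p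
    dsimp only
    have hdis : Disjoint (S ∩ T) (S ∆ T) := by
      rw [Finset.disjoint_left]; intro a ha hb; rw [mem_inter] at ha; rw [mem_symmDiff] at hb; tauto
    have hsub : S \ T ⊆ S ∆ T := by intro a ha; rw [mem_sdiff] at ha; rw [mem_symmDiff]; tauto
    have eS : S ∩ T ∪ S \ T = S := by ext a; simp only [mem_union, mem_inter, mem_sdiff]; tauto
    have eT : S ∩ T ∪ (S ∆ T \ (S \ T)) = T := by
      ext a; simp only [mem_union, mem_inter, mem_sdiff, mem_symmDiff]; tauto
    rw [← prodW_mul_prodW_fibre w hdis hsub, eS, eT]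

/-- **Positivity transfer**: nonnegative antipodal fibre sums on every sub-cube give a nonnegative two-sample expectation for every product
measure. [this work] -/
theorem sum_sum_prodW_mul_nonneg_of_fibre {w : α → ℝ} (hw : ∀ i, 0 ≤ w i ∧ w i ≤ 1) (K : Finset α → Finset α → ℝ)
    (hK : ∀ I D : Finset α, Disjoint I D → 0 ≤ ∑ x ∈ D.powerset, K (I ∪ x) (I ∪ (D \ x))) :
    0 ≤ ∑ S, ∑ T, prodW w S * prodW w T * K S T := by
  rw [sum_sum_prodW_mul_eq_sum_fibre, fibreIdx, sum_sigma]
  refine sum_nonneg fun p hp => ?_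
  rw [mem_filter] at hp
  dsimp only
  rw [← mul_sum]
  exact mul_nonneg (fibreW_nonneg hw _ _) (hK _ _ hp.2)
/-! ### Probabilities of families and bilinear bookkeeping -/

/-- `P_w(𝒳) = Σ_{S ∈ 𝒳} prodW w S`. [this work] -/
def prob (w : α → ℝ) (𝒳 : Finset (Finset α)) : ℝ := ∑ S, prodW w S * (if S ∈ 𝒳 then 1 else 0)
/-- The indicator of a family as a real function. [this work] -/
def fInd (𝒳 : Finset (Finset α)) (S : Finset α) : ℝ := if S ∈ 𝒳 then 1 else 0

/-- `prob` through the indicator. [this work] -/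
theorem prob_eq (w : α → ℝ) (𝒳 : Finset (Finset α)) : prob w 𝒳 = ∑ S, prodW w S * fInd 𝒳 S := rfl
/-- Two-sample expectation of a product kernel factorises. [folklore] -/
theorem sum_sum_prodW_mul_mul (w : α → ℝ) (f g : Finset α → ℝ) :
    ∑ S, ∑ T, prodW w S * prodW w T * (f S * g T) = (∑ S, prodW w S * f S) * ∑ T, prodW w T * g T := by
  rw [sum_mul_sum]
  exact sum_congr rfl fun S _ => sum_congr rfl fun T _ => by ring

/-- The SQKD kernel: `K(S,T) = 1_{𝒜ℬ𝒞}(S)(1 + 1_𝒜(T)) − 1_{𝒜ℬ}(S)1_{𝒜𝒞}(T) − 1_𝒜(S)1_{ℬ𝒞}(T)`. [this work] -/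
def sqkdK (𝒜 ℬ 𝒞 : Finset (Finset α)) (S T : Finset α) : ℝ :=
  fInd (𝒜 ∩ ℬ ∩ 𝒞) S * (1 + fInd 𝒜 T) - fInd (𝒜 ∩ ℬ) S * fInd (𝒜 ∩ 𝒞) T - fInd 𝒜 S * fInd (ℬ ∩ 𝒞) T

/-- **The two-sample expectation of the SQKD kernel is `(1 + P𝒜)·P(𝒜ℬ𝒞) − P(𝒜ℬ)·P(𝒜𝒞) − P𝒜·P(ℬ𝒞)`.** [this work] -/
theorem sum_sum_sqkdK (w : α → ℝ) (𝒜 ℬ 𝒞 : Finset (Finset α)) :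
    ∑ S, ∑ T, prodW w S * prodW w T * sqkdK 𝒜 ℬ 𝒞 S T =
      (1 + prob w 𝒜) * prob w (𝒜 ∩ ℬ ∩ 𝒞) - prob w (𝒜 ∩ ℬ) * prob w (𝒜 ∩ 𝒞) - prob w 𝒜 * prob w (ℬ ∩ 𝒞) := by
  have e : ∀ S T, prodW w S * prodW w T * sqkdK 𝒜 ℬ 𝒞 S T =
      prodW w S * prodW w T * (fInd (𝒜 ∩ ℬ ∩ 𝒞) S * (1 + fInd 𝒜 T))
      - prodW w S * prodW w T * (fInd (𝒜 ∩ ℬ) S * fInd (𝒜 ∩ 𝒞) T)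
      - prodW w S * prodW w T * (fInd 𝒜 S * fInd (ℬ ∩ 𝒞) T) := by
    intro S T; unfold sqkdK; ring
  simp_rw [e, Finset.sum_sub_distrib, sum_sum_prodW_mul_mul]
  simp only [prob_eq]
  have h1 : ∑ T, prodW w T * (1 + fInd 𝒜 T) = 1 + ∑ T, prodW w T * fInd 𝒜 T := by
    simp_rw [mul_add, mul_one, Finset.sum_add_distrib, sum_prodW]
  rw [h1]; ring

/-- **SQKD from nonnegative antipodal fibre sums** (hypothesis = the comb statement on every sub-cube of `α`). [this work] -/
theorem sqkd_of_fibre {w : α → ℝ} (hw : ∀ i, 0 ≤ w i ∧ w i ≤ 1) (𝒜 ℬ 𝒞 : Finset (Finset α))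
    (hK : ∀ I D : Finset α, Disjoint I D → 0 ≤ ∑ x ∈ D.powerset, sqkdK 𝒜 ℬ 𝒞 (I ∪ x) (I ∪ (D \ x))) :
    prob w (𝒜 ∩ ℬ) * prob w (𝒜 ∩ 𝒞) + prob w 𝒜 * prob w (ℬ ∩ 𝒞) ≤ (1 + prob w 𝒜) * prob w (𝒜 ∩ ℬ ∩ 𝒞) := by
  have h := sum_sum_prodW_mul_nonneg_of_fibre hw (sqkdK 𝒜 ℬ 𝒞) hK
  rw [sum_sum_sqkdK] at h
  linarith
/-! ### The fibre sums are the three-set antipodal functional of the SECTIONS -/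

section Sections

variable (I D : Finset α)

/-- The section of a family at the fibre `(I,D)`, as a family of subsets of `↥D`: `{y : I ∪ y ∈ 𝒳}`. [this work] -/
def sec (𝒳 : Finset (Finset α)) : Finset (Finset D) :=
  univ.filter fun y => I ∪ y.map (Function.Embedding.subtype (· ∈ D)) ∈ 𝒳

omit [Fintype α] in
/-- Membership in a section. [this work] -/
theorem mem_sec {𝒳 : Finset (Finset α)} {y : Finset D} : y ∈ sec I D 𝒳 ↔ I ∪ y.map (Function.Embedding.subtype (· ∈ D)) ∈ 𝒳 := by
  simp [sec]
omit [Fintype α] in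
/-- Sections of up-sets are up-sets. [this work] -/
theorem isUpperSet_sec {𝒳 : Finset (Finset α)} (h : IsUpperSet (𝒳 : Set (Finset α))) :
    IsUpperSet ((sec I D 𝒳 : Finset (Finset D)) : Set (Finset D)) := by
  intro y y' hyy' hy
  rw [mem_coe, mem_sec] at hy ⊢
  exact h (union_subset_union (le_refl I) (map_subset_map.2 hyy')) hy

omit [Fintype α] in
/-- Sections commute with intersection. [this work] -/
theorem sec_inter (𝒳 𝒴 : Finset (Finset α)) : sec I D (𝒳 ∩ 𝒴) = sec I D 𝒳 ∩ sec I D 𝒴 := by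
  ext y; simp only [mem_sec, mem_inter]
omit [Fintype α] in
/-- Complementation inside `↥D` corresponds to `x ↦ D ∖ x`. [this work] -/
theorem map_compl_subtype (y : Finset D) :
    (yᶜ).map (Function.Embedding.subtype (· ∈ D)) = D \ y.map (Function.Embedding.subtype (· ∈ D)) := by
  rw [compl_eq_univ_sdiff, map_sdiff, Finset.univ_eq_attach, attach_map_val]

omit [Fintype α] in
/-- Membership in the complement family of a section. [this work] -/
theorem mem_compls_sec {𝒳 : Finset (Finset α)} {y : Finset D} :
    y ∈ (sec I D 𝒳)ᶜˢ ↔ I ∪ (D \ y.map (Function.Embedding.subtype (· ∈ D))) ∈ 𝒳 := by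
  rw [mem_compls, mem_sec, map_compl_subtype]

omit [Fintype α] in
/-- A sum over the subsets of `D` is a sum over `Finset ↥D`. [folklore] -/
theorem sum_powerset_eq_sum_subtype (f : Finset α → ℝ) :
    ∑ x ∈ D.powerset, f x = ∑ y : Finset D, f (y.map (Function.Embedding.subtype (· ∈ D))) := by
  refine Finset.sum_nbij' (fun x => x.subtype (· ∈ D)) (fun y => y.map (Function.Embedding.subtype (· ∈ D))) ?_ ?_ ?_ ?_ ?_
  · intro x _; exact mem_univ _
  · intro y _; rw [mem_powerset]; intro a ha; exact property_of_mem_map_subtype y ha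
  · intro x hx; rw [mem_powerset] at hx; exact subtype_map_of_mem fun a ha => hx ha
  · intro y _; ext a; simp
  · intro x hx; rw [mem_powerset] at hx; rw [subtype_map_of_mem fun a ha => hx ha]

omit [Fintype α] in
/-- A count in `Finset ↥D` as a sum of an indicator. [folklore] -/
theorem card_eq_sum_fInd (𝒴 : Finset (Finset D)) : (#𝒴 : ℝ) = ∑ y : Finset D, (if y ∈ 𝒴 then (1:ℝ) else 0) := by
  rw [Finset.sum_boole, filter_mem_eq_inter, univ_inter]

omit [Fintype α] in
/-- **The fibre sum of the SQKD kernel is `threeSetN` of the sections.** [this work] -/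
theorem fibre_sum_sqkdK_eq_threeSetN (𝒜 ℬ 𝒞 : Finset (Finset α)) :
    ∑ x ∈ D.powerset, sqkdK 𝒜 ℬ 𝒞 (I ∪ x) (I ∪ (D \ x)) = (threeSetN (sec I D 𝒜) (sec I D ℬ) (sec I D 𝒞) : ℝ) := by
  rw [sum_powerset_eq_sum_subtype]
  unfold threeSetN
  push_cast
  rw [card_eq_sum_fInd, card_eq_sum_fInd, card_eq_sum_fInd, card_eq_sum_fInd, ← Finset.sum_add_distrib, ← Finset.sum_sub_distrib,
    ← Finset.sum_sub_distrib]
  refine Finset.sum_congr rfl fun y _ => ?_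
  simp only [sqkdK, fInd, mem_inter, mem_compls_sec I D, mem_sec I D]
  set e := Function.Embedding.subtype (· ∈ D)
  by_cases hA : I ∪ y.map e ∈ 𝒜 <;> by_cases hB : I ∪ y.map e ∈ ℬ <;> by_cases hC : I ∪ y.map e ∈ 𝒞 <;>
    by_cases hA' : I ∪ (D \ y.map e) ∈ 𝒜 <;> by_cases hB' : I ∪ (D \ y.map e) ∈ ℬ <;> by_cases hC' : I ∪ (D \ y.map e) ∈ 𝒞 <;>
    simp [hA, hB, hC, hA', hB', hC']

end Sections

/-- **SQKD for every product measure on the cube `2^α`, CONDITIONALLY on the three-set antipodal statement for every sub-cube of `α`.** [this work] -/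
theorem sqkd_of_threeSetN_nonneg {w : α → ℝ} (hw : ∀ i, 0 ≤ w i ∧ w i ≤ 1) (𝒜 ℬ 𝒞 : Finset (Finset α))
    (h𝒜 : IsUpperSet (𝒜 : Set (Finset α))) (hℬ : IsUpperSet (ℬ : Set (Finset α))) (h𝒞 : IsUpperSet (𝒞 : Set (Finset α)))
    (hBase : ∀ (D : Finset α) (𝒜' ℬ' 𝒞' : Finset (Finset D)), IsUpperSet (𝒜' : Set (Finset D)) → IsUpperSet (ℬ' : Set (Finset D)) →
      IsUpperSet (𝒞' : Set (Finset D)) → 0 ≤ threeSetN 𝒜' ℬ' 𝒞') :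
    prob w (𝒜 ∩ ℬ) * prob w (𝒜 ∩ 𝒞) + prob w 𝒜 * prob w (ℬ ∩ 𝒞) ≤ (1 + prob w 𝒜) * prob w (𝒜 ∩ ℬ ∩ 𝒞) := by
  refine sqkd_of_fibre hw 𝒜 ℬ 𝒞 fun I D _ => ?_
  rw [fibre_sum_sqkdK_eq_threeSetN]
  exact_mod_cast hBase D _ _ _ (isUpperSet_sec I D h𝒜) (isUpperSet_sec I D hℬ) (isUpperSet_sec I D h𝒞)
/-! ### Transport along a bijection of the ground set: `ThreeSetAntipodal` (stated on `Fin n`) gives the hypothesis on every sub-cube -/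

section Transport

variable {β γ : Type*}

/-- Round trip of a set along a bijection and back. [folklore] -/
theorem map_map_symm (e : β ≃ γ) (s : Finset β) : (s.map e.toEmbedding).map e.symm.toEmbedding = s := by
  ext b; simp [mem_map_equiv]
/-- Round trip the other way. [folklore] -/
theorem map_symm_map (e : β ≃ γ) (t : Finset γ) : (t.map e.symm.toEmbedding).map e.toEmbedding = t := by
  ext c; simp [mem_map_equiv]

/-- Push a family of sets forward along a bijection of the ground set. [this work] -/
def famMap (e : β ≃ γ) (𝒳 : Finset (Finset β)) : Finset (Finset γ) := 𝒳.map ⟨fun s => s.map e.toEmbedding, map_injective _⟩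

/-- Membership in the pushed-forward family. [this work] -/
theorem mem_famMap {e : β ≃ γ} {𝒳 : Finset (Finset β)} {t : Finset γ} : t ∈ famMap e 𝒳 ↔ t.map e.symm.toEmbedding ∈ 𝒳 := by
  unfold famMap
  rw [mem_map]
  constructor
  · rintro ⟨s, hs, rfl⟩
    show (s.map e.toEmbedding).map e.symm.toEmbedding ∈ 𝒳
    rw [map_map_symm]; exact hs
  · intro h
    exact ⟨t.map e.symm.toEmbedding, h, map_symm_map e t⟩

/-- Intersections are preserved. [this work] -/
theorem famMap_inter [DecidableEq β] [DecidableEq γ] (e : β ≃ γ) (𝒳 𝒴 : Finset (Finset β)) :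
    famMap e (𝒳 ∩ 𝒴) = famMap e 𝒳 ∩ famMap e 𝒴 := by
  ext t; simp only [mem_famMap, mem_inter]
/-- Complement families are preserved. [this work] -/
theorem famMap_compls [DecidableEq β] [Fintype β] [DecidableEq γ] [Fintype γ] (e : β ≃ γ) (𝒳 : Finset (Finset β)) :
    famMap e 𝒳ᶜˢ = (famMap e 𝒳)ᶜˢ := by
  ext t
  rw [mem_famMap, mem_compls, mem_compls, mem_famMap]
  have : tᶜ.map e.symm.toEmbedding = (t.map e.symm.toEmbedding)ᶜ := by
    ext b
    simp only [mem_map_equiv, Equiv.symm_symm, mem_compl]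
  rw [this]

/-- Cardinality is preserved. [this work] -/
theorem card_famMap (e : β ≃ γ) (𝒳 : Finset (Finset β)) : #(famMap e 𝒳) = #𝒳 := card_map _
/-- Up-sets are preserved. [this work] -/
theorem isUpperSet_famMap (e : β ≃ γ) {𝒳 : Finset (Finset β)} (h : IsUpperSet (𝒳 : Set (Finset β))) :
    IsUpperSet ((famMap e 𝒳 : Finset (Finset γ)) : Set (Finset γ)) := by
  intro t t' htt' ht
  rw [mem_coe, mem_famMap] at ht ⊢
  exact h (map_subset_map.2 htt') ht

/-- `threeSetN` is invariant. [this work] -/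
theorem threeSetN_famMap [DecidableEq β] [Fintype β] [DecidableEq γ] [Fintype γ] (e : β ≃ γ) (𝒜 ℬ 𝒞 : Finset (Finset β)) :
    threeSetN (famMap e 𝒜) (famMap e ℬ) (famMap e 𝒞) = threeSetN 𝒜 ℬ 𝒞 := by
  unfold threeSetN
  simp only [← famMap_inter, ← famMap_compls, card_famMap]

/-- **`ThreeSetAntipodal` transports to every finite ground type.** [this work] -/
theorem threeSetN_nonneg_of_threeSetAntipodal [DecidableEq β] [Fintype β] (h : ThreeSetAntipodal) (𝒜 ℬ 𝒞 : Finset (Finset β))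
    (h𝒜 : IsUpperSet (𝒜 : Set (Finset β))) (hℬ : IsUpperSet (ℬ : Set (Finset β))) (h𝒞 : IsUpperSet (𝒞 : Set (Finset β))) :
    0 ≤ threeSetN 𝒜 ℬ 𝒞 := by
  let e := Fintype.equivFin β
  rw [← threeSetN_famMap e]
  exact h _ _ _ _ (isUpperSet_famMap e h𝒜) (isUpperSet_famMap e hℬ) (isUpperSet_famMap e h𝒞)

end Transport

/-- **SQKD for every product measure on every finite cube, conditionally on `ThreeSetAntipodal`**:
`(1 + P𝒜)·P(𝒜∩ℬ∩𝒞) ≥ P(𝒜∩ℬ)·P(𝒜∩𝒞) + P𝒜·P(ℬ∩𝒞)`, i.e. `Cov(1_{A∩B},1_{A∩C}) ≥ P(A)·P(B∩C∖A)`. [this work] [status: conditional on the conjecture] -/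
theorem sqkd_of_threeSetAntipodal (h : ThreeSetAntipodal) {w : α → ℝ} (hw : ∀ i, 0 ≤ w i ∧ w i ≤ 1) (𝒜 ℬ 𝒞 : Finset (Finset α))
    (h𝒜 : IsUpperSet (𝒜 : Set (Finset α))) (hℬ : IsUpperSet (ℬ : Set (Finset α))) (h𝒞 : IsUpperSet (𝒞 : Set (Finset α))) :
    prob w (𝒜 ∩ ℬ) * prob w (𝒜 ∩ 𝒞) + prob w 𝒜 * prob w (ℬ ∩ 𝒞) ≤ (1 + prob w 𝒜) * prob w (𝒜 ∩ ℬ ∩ 𝒞) :=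
  sqkd_of_threeSetN_nonneg hw 𝒜 ℬ 𝒞 h𝒜 hℬ h𝒞 fun _ 𝒜' ℬ' 𝒞' h1 h2 h3 => threeSetN_nonneg_of_threeSetAntipodal h 𝒜' ℬ' 𝒞' h1 h2 h3
/-! ### The same machine, unconditionally: Harris for product measures from `twoPartN ≥ 0` -/

/-- The Harris kernel `1_{𝒰∩𝒱}(S) − 1_𝒰(S)1_𝒱(T)`. [this work] -/
def harrisK (𝒰 𝒱 : Finset (Finset α)) (S T : Finset α) : ℝ := fInd (𝒰 ∩ 𝒱) S - fInd 𝒰 S * fInd 𝒱 T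

/-- Its two-sample expectation is `P(𝒰∩𝒱) − P𝒰·P𝒱`. [this work] -/
theorem sum_sum_harrisK (w : α → ℝ) (𝒰 𝒱 : Finset (Finset α)) :
    ∑ S, ∑ T, prodW w S * prodW w T * harrisK 𝒰 𝒱 S T = prob w (𝒰 ∩ 𝒱) - prob w 𝒰 * prob w 𝒱 := by
  have e : ∀ S T, prodW w S * prodW w T * harrisK 𝒰 𝒱 S T =
      prodW w S * prodW w T * (fInd (𝒰 ∩ 𝒱) S * 1) - prodW w S * prodW w T * (fInd 𝒰 S * fInd 𝒱 T) := by
    intro S T; unfold harrisK; ring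
  simp_rw [e, Finset.sum_sub_distrib, sum_sum_prodW_mul_mul]
  simp only [prob_eq, mul_one, sum_prodW]

omit [Fintype α] in
/-- The fibre sum of the Harris kernel is `twoPartN` of the sections. [this work] -/
theorem fibre_sum_harrisK_eq_twoPartN (I D : Finset α) (𝒰 𝒱 : Finset (Finset α)) :
    ∑ x ∈ D.powerset, harrisK 𝒰 𝒱 (I ∪ x) (I ∪ (D \ x)) = (twoPartN (sec I D 𝒰) (sec I D 𝒱) : ℝ) := by
  rw [sum_powerset_eq_sum_subtype]
  unfold twoPartN
  push_cast
  rw [card_eq_sum_fInd, card_eq_sum_fInd, ← Finset.sum_sub_distrib]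
  refine Finset.sum_congr rfl fun y _ => ?_
  simp only [harrisK, fInd, mem_inter, mem_compls_sec I D, mem_sec I D]
  set e := Function.Embedding.subtype (· ∈ D)
  by_cases hU : I ∪ y.map e ∈ 𝒰 <;> by_cases hV : I ∪ y.map e ∈ 𝒱 <;> by_cases hV' : I ∪ (D \ y.map e) ∈ 𝒱 <;> simp [hU, hV, hV']

/-- **Harris's inequality for product measures on `2^α`, from the two-copy comb statement `twoPartN ≥ 0`** (a second proof of a classical fact,
recorded as a check of the fibre machine). [this work] -/
theorem harris_of_twoPartN {w : α → ℝ} (hw : ∀ i, 0 ≤ w i ∧ w i ≤ 1) (𝒰 𝒱 : Finset (Finset α))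
    (h𝒰 : IsUpperSet (𝒰 : Set (Finset α))) (h𝒱 : IsUpperSet (𝒱 : Set (Finset α))) :
    prob w 𝒰 * prob w 𝒱 ≤ prob w (𝒰 ∩ 𝒱) := by
  have h := sum_sum_prodW_mul_nonneg_of_fibre hw (harrisK 𝒰 𝒱) fun I D _ => by
    rw [fibre_sum_harrisK_eq_twoPartN]
    exact_mod_cast twoPartN_nonneg (isUpperSet_sec I D h𝒰) (isUpperSet_sec I D h𝒱)
  rw [sum_sum_harrisK] at h
  linarith

end Summit.CriticalPhenomena.PercolationContinuityZ3.Theorems.TwoPartition
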